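import Literature.AlgebraicGeometry.Liu2021.AlbaneseUnitaryShimura

/-!
# Liu 2021: multiplicity one in the Albanese cohomology, and what it implies for the index triples

Yifeng Liu, *Fourier–Jacobi cycles and arithmetic relative trace formula*, Cambridge J. Math. 9 (2021),
no. 1, 1–147 = arXiv:2102.11518 [Liu2021], §4.2.  Companion to `AlbaneseUnitaryShimura.lean` (the typed skeleton of
§4.2 over the bare carriers `LiuAlbaneseDatum`: `Prop413` as the multiplicity statement, `Thm418_2`, `Cor420`, and
the kernel consequence `Prop413.mult_le_one` which takes the cross-character separation «distinct `μ` never give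
isomorphic `ω(μ, ε, χ)`» as an explicit hypothesis `hμ`, flagged there as "NOT printed as such").

WHAT IS ADDED.  One further printed sentence of §4.2 is typed over the SAME carriers — the MULTIPLICITY-ONE sentence
(running text following Prop. 4.13, and the last sentence of the proof of Prop. 4.13), as the predicate
`LiuAlbaneseDatum.MultOne` — and its kernel relation to the two separation predicates is proved:

* `MultOne.sigma_eq_of_omega_eq` / `MultOne.char_eq_of_omega_eq` / `MultOne.thm418_2`: given `Prop413` (as typed:
  the multiplicity of `ρ` in `H¹_{B,τ'}(A_∞, ℂ)` is the number of index triples `t` with `ω(t) = ρ`) and `3 ≤ n`,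
  multiplicity one at ONE embedding `τ'` implies that distinct index triples have distinct `ω` — i.e. BOTH the
  hypothesis `hμ` of `Prop413.mult_le_one` (the shape of the stage-1 model's displayed hypothesis `MuSeparated`)
  AND `Thm418_2`;
* `multOne_of_separated`: conversely `Prop413 ∧ Thm418_2 ∧ hμ ⟹ MultOne`;
* `multOne_iff_separated`: so, given `Prop413` and `3 ≤ n` and one embedding, `MultOne ↔ (hμ ∧ Thm418_2)`;
* `MultOne.h1mult_le_one`, `MultOne.h1mult_eq_one_iff`: every irreducible occurs with multiplicity `≤ 1`, and with
  multiplicity `1` exactly when it is some `ω(t)`.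

WHY (CITATION-FIT row CF07, finding F-18 of the second Liu seat, 2026-08-21).  In the combined reading r8 of
Thm. 4.18 (the stage-1 record `Thm418Combined`/`Thm418C`, stated on the INTRINSIC block `⨆_{(ε,χ)} Σ_ψ range ψ`
of all equivariant images of the `ω(μ, ε, χ)` in `H¹`), the step «image of the pull-back map (4.2) = the intrinsic
`μ`-block» needs that no index summand `ω(μ', ε', χ')` with `μ' ≠ μ` is isomorphic to an `ω(μ, ε, χ)`.  Thm. 4.18 (2)
gives non-isomorphy only WITHIN a fixed `μ`; the cross-`μ` statement is, on these carriers, EXACTLY the printed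
multiplicity-one sentence (this file), so a consumer that no longer displays `MuSeparated` as a hypothesis (the
single-block junction of the stage-1 «JB» lineage) sources that step in print at TeX ll. 2145 / 2163–2166, not in a
model hypothesis.  Liu's own route to the same separation is local: Thm. 4.18 (2) "follows from Lemma D.1" (l. 2270),
App. D Lem. D.1 (3) being a statement about `U(V)(F_v)`-modules at one finite place; that route is the one wired in
`Literature/RepresentationTheory/Liu2021/GlobalOscillatorIsomorphismCriterion.lean`.  Nothing here asserts anything:
all statements are predicates over / implications between hypotheses on a consumer's own datum.

Quotations AS PRINTED were read on the author's TeX source (`FJcycle.tex`, arXiv e-print v2, md5 6db49a74122d; line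
numbers `l. NNNN` refer to it) and on the held extraction `paper:arxiv-2102.11518` (chunks p0020–p0021).

## References

* [Liu2021] Y. Liu, *Fourier–Jacobi cycles and arithmetic relative trace formula*, Camb. J. Math. 9 (2021) 1–147,
  arXiv:2102.11518 — Def. 4.11, Prop. 4.13 with its proof (l. 2145), the text of §4.2 following it (ll. 2152–2175,
  esp. ll. 2163–2166), Thm. 4.15, Thm. 4.18 (2) (l. 2241) and its proof sentence (l. 2270), App. D Lem. D.1 (3).
-/

namespace Literature.AlgebraicGeometry.Liu2021

universe u w

namespace LiuAlbaneseDatum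

variable {Isog : Type w}

/-- **[Liu2021, §4.2, the sentence following Prop. 4.13]** (`FJcycle.tex` ll. 2163–2166; chunk p0021), AS PRINTED:
"Suppose that `n ≥ 3` and consider an adèlic oscillator triple `(μ, ε, χ)` in which `μ` is of weight one and `ε` is
`μ`-admissible. Then `Hom_{ℚ_ℓ^ac[G(𝔸_F^∞)]}(ι_ℓ ∘ ω(μ, ε, χ), H¹_ét(A_∞ ⊗_{E,τ'} ℂ, ℚ_ℓ^ac))` is a representation
of `Gal(ℂ/τ'(E))` over `ℚ_ℓ^ac`. By Proposition 4.13, such representation is an `ℓ`-adic character, denoted by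
`ρ_{τ',ι_ℓ}(μ, ε, χ) : Gal(ℂ/τ'(E)) → (ℚ_ℓ^ac)^×`."  — i.e. the `ω(μ, ε, χ)`-multiplicity space of
`H¹_ét(A_∞ ⊗_{E,τ'} ℂ, ℚ_ℓ^ac) ≅ H¹_{B,τ'}(A_∞, ℂ) ⊗_{ℂ,ι_ℓ} ℚ_ℓ^ac` (comparison isomorphism, l. 2155) is ONE-dimensional,
for every embedding `τ'` and every index triple; equivalently the last sentence of the proof of Prop. 4.13
(l. 2145), AS PRINTED: "… if an irreducible admissible representation `π` of `G(𝔸)` contributes to the Albanese,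
then `π^∞ ≃ ω(μ, ε, χ)` for a unique adèlic oscillator triple in which `μ` is of weight one and `ε` is
`μ`-admissible, and `m_disc(π) = 1`. Conversely, for every such adèlic oscillator triple `(μ, ε, χ)`, there exists a
pair `(W, π_W)` … such that … `ω(μ, ε, χ)` is isomorphic to `π^∞` and `H¹(𝔤, K_G; π_∞) ≠ {0}`. … Thus, we may
apply the above discussions to the representation `π` to conclude that the dimension of
`H¹_{B,τ'}(A_∞, ℂ)[ω(μ, ε, χ)]` is `1`."
TYPING, over the carriers of `AlbaneseUnitaryShimura.lean` (`H1mult τ' ρ` = the multiplicity of the irreducible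
`ρ` in `H¹_{B,τ'}(A_∞, ℂ)`; `omega μ a = ω(μ, ε, χ)` for the index triple `(μ, (ε, χ))`, `ε` `μ`-admissible, `μ` of
weight one): when `n ≥ 3`, every index representation occurs with multiplicity exactly one, at every embedding.
Nothing is asserted (a predicate on a consumer's datum). [cite: Liu2021, §4.2 (text following Prop. 4.13) and proof of Prop. 4.13] -/
def MultOne (D : LiuAlbaneseDatum.{u, w} Isog) : Prop :=
  3 ≤ D.n → ∀ (τ' : D.Emb) (μ : D.Char) (a : D.Adm μ), D.H1mult τ' (D.omega μ a) = 1

variable {D : LiuAlbaneseDatum.{u, w} Isog}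

/-- Under Prop. 4.13 (as typed) and multiplicity one at some embedding `τ'`, the fibre of `ω` over an index value
is a one-element type (the sentence of l. 2145 «the dimension of `H¹_{B,τ'}(A_∞, ℂ)[ω(μ, ε, χ)]` is `1`», read through
Prop. 4.13 as typed). [cite: Liu2021, Prop. 4.13 (proof, last sentence)] -/
theorem MultOne.card_fibre_eq_one (h : D.Prop413) (h1 : D.MultOne) (hn : 3 ≤ D.n) (τ' : D.Emb)
    (μ : D.Char) (a : D.Adm μ) :
    Nat.card {t : (ν : D.Char) × D.Adm ν // D.omega t.1 t.2 = D.omega μ a} = 1 := by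
  rw [← h hn τ' (D.omega μ a)]
  exact h1 hn τ' μ a

/-- **Multiplicity one separates the index triples.**  Given Prop. 4.13 (as typed), `n ≥ 3` and one embedding
`τ'`, the printed multiplicity-one sentence implies: index triples with the same `ω` are EQUAL (as dependent
pairs) — AS PRINTED (proof of Prop. 4.13, l. 2145): "… then `π^∞ ≃ ω(μ, ε, χ)` for a unique adèlic oscillator triple in
which `μ` is of weight one and `ε` is `μ`-admissible". [cite: Liu2021, Prop. 4.13 (proof, l. 2145: uniqueness of the triple)] -/
theorem MultOne.sigma_eq_of_omega_eq (h : D.Prop413) (h1 : D.MultOne) (hn : 3 ≤ D.n) (τ' : D.Emb)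
    {μ μ' : D.Char} {a : D.Adm μ} {b : D.Adm μ'} (he : D.omega μ a = D.omega μ' b) :
    (⟨μ, a⟩ : (ν : D.Char) × D.Adm ν) = ⟨μ', b⟩ := by
  have hsub : Subsingleton {t : (ν : D.Char) × D.Adm ν // D.omega t.1 t.2 = D.omega μ a} :=
    (Nat.card_eq_one_iff_unique.mp (h1.card_fibre_eq_one h hn τ' μ a)).1
  have hxy := hsub.elim ⟨⟨μ, a⟩, rfl⟩ ⟨⟨μ', b⟩, he.symm⟩
  exact congrArg Subtype.val hxy

/-- **The cross-character separation from print.**  Given Prop. 4.13 (as typed), `n ≥ 3` and one embedding,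
multiplicity one implies the hypothesis `hμ` of `Prop413.mult_le_one` — distinct weight-one characters `μ ≠ μ'`
never give isomorphic `ω(μ, ε, χ) ≅ ω(μ', ε', χ')` (the shape of the stage-1 model's displayed hypothesis
`MuSeparated`); the `μ`-component of the printed uniqueness of the triple (proof of Prop. 4.13, l. 2145).
[cite: Liu2021, Prop. 4.13 (proof, l. 2145: uniqueness of the triple)] -/
theorem MultOne.char_eq_of_omega_eq (h : D.Prop413) (h1 : D.MultOne) (hn : 3 ≤ D.n) (τ' : D.Emb)
    (μ μ' : D.Char) (a : D.Adm μ) (b : D.Adm μ') (he : D.omega μ a = D.omega μ' b) : μ = μ' :=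
  congrArg Sigma.fst (h1.sigma_eq_of_omega_eq h hn τ' he)

/-- **Thm. 4.18 (2) from print's multiplicity one.**  Given Prop. 4.13 (as typed), `n ≥ 3` and one embedding,
multiplicity one implies `Thm418_2` (for fixed `μ`, `(ε, χ) ↦ ω(μ, ε, χ)` is injective on admissible pairs) —
AS PRINTED (l. 2241): "The `ℂ[G(𝔸_F^∞)]`-modules in the direct sum in Theorem 4.18 are mutually non-isomorphic."
[cite: Liu2021, Thm. 4.18 (2)] -/
theorem MultOne.thm418_2 (h : D.Prop413) (h1 : D.MultOne) (hn : 3 ≤ D.n) (τ' : D.Emb) : D.Thm418_2 := by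
  intro μ a b he
  have hs := h1.sigma_eq_of_omega_eq h hn τ' he
  simp only [Sigma.mk.injEq, heq_eq_eq, true_and] at hs
  exact hs

/-- Conversely, Prop. 4.13 (as typed) with BOTH separations (`Thm418_2` within a character, `hμ` across
characters) gives multiplicity one: the fibre of `ω` over `ω(μ, ε, χ)` is the single index `(μ, (ε, χ))` — this is
the printed inference "By Proposition 4.13, such representation is an `ℓ`-adic character" (l. 2166: multiplicity one FROM
the decomposition of Prop. 4.13 and the non-isomorphy of its summands). [cite: Liu2021, §4.2 (text following Prop. 4.13, l. 2166)] -/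
theorem multOne_of_separated (h : D.Prop413) (h2 : D.Thm418_2)
    (hμ : ∀ (μ μ' : D.Char) (a : D.Adm μ) (b : D.Adm μ'), D.omega μ a = D.omega μ' b → μ = μ') :
    D.MultOne := by
  intro hn τ' μ a
  rw [h hn τ' (D.omega μ a)]
  refine Nat.card_eq_one_iff_unique.mpr ⟨⟨fun x y => Subtype.ext ?_⟩, ⟨⟨⟨μ, a⟩, rfl⟩⟩⟩
  obtain ⟨⟨ν, c⟩, hx⟩ := x
  obtain ⟨⟨ν', c'⟩, hy⟩ := y
  have hνν' : ν = ν' := hμ ν ν' c c' (hx.trans hy.symm)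
  subst hνν'
  have hcc' : c = c' := h2 ν c c' (hx.trans hy.symm)
  subst hcc'
  rfl

/-- **Equivalence.**  Given Prop. 4.13 (as typed), `n ≥ 3` and an embedding `τ'`: the printed multiplicity-one
sentence holds iff the index triples are separated both within and across characters (ll. 2145, 2166 and Thm. 4.18 (2) read together).
[cite: Liu2021, §4.2 (l. 2166) with Prop. 4.13 (proof, l. 2145) and Thm. 4.18 (2)] -/
theorem multOne_iff_separated (h : D.Prop413) (hn : 3 ≤ D.n) (τ' : D.Emb) :
    D.MultOne ↔
      (∀ (μ μ' : D.Char) (a : D.Adm μ) (b : D.Adm μ'), D.omega μ a = D.omega μ' b → μ = μ') ∧ D.Thm418_2 :=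
  ⟨fun h1 => ⟨h1.char_eq_of_omega_eq h hn τ', h1.thm418_2 h hn τ'⟩,
    fun hs => multOne_of_separated h hs.2 hs.1⟩

/-- Multiplicity one for the index representations implies multiplicity `≤ 1` for EVERY irreducible (those that
are no `ω(t)` have multiplicity `0` by Prop. 4.13) — the printed "`m_disc(π) = 1`" / "dimension … is `1`" of l. 2145 for every
contributing `π`. [cite: Liu2021, Prop. 4.13 (proof, l. 2145)] -/
theorem MultOne.h1mult_le_one (h : D.Prop413) (h1 : D.MultOne) (hn : 3 ≤ D.n) (τ' : D.Emb) (ρ : D.Rep) :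
    D.H1mult τ' ρ ≤ 1 :=
  Prop413.mult_le_one h (h1.thm418_2 h hn τ') hn (h1.char_eq_of_omega_eq h hn τ') τ' ρ

/-- … and multiplicity exactly `1` iff `ρ` is one of the `ω(t)` — AS PRINTED (l. 2145): a representation contributes to the
Albanese iff its finite part is some `ω(μ, ε, χ)`, and then with multiplicity one. [cite: Liu2021, Prop. 4.13 (proof, l. 2145)] -/
theorem MultOne.h1mult_eq_one_iff (h : D.Prop413) (h1 : D.MultOne) (hn : 3 ≤ D.n) (τ' : D.Emb) (ρ : D.Rep) :
    D.H1mult τ' ρ = 1 ↔ ∃ (μ : D.Char) (a : D.Adm μ), D.omega μ a = ρ := by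
  constructor
  · intro hρ
    rw [h hn τ' ρ] at hρ
    obtain ⟨⟨⟨μ, a⟩, hμa⟩⟩ := (Nat.card_eq_one_iff_unique.mp hρ).2
    exact ⟨μ, a, hμa⟩
  · rintro ⟨μ, a, rfl⟩
    exact h1 hn τ' μ a

end LiuAlbaneseDatum

end Literature.AlgebraicGeometry.Liu2021
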